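import Summits.KontsevichZagierPeriods.KontsevichZagierPeriods.Theorems.AperySectorThreeTwo.Negative.Kit
import Literature.NumberTheory.Transcendental.KZLogCalculusProofs

/-!
# `AperySectorThreeTwo` (stmt-KontsevichZagierPeriods-3873), line `flattening-dilation`:
# the stub set is TIGHT — load-bearing hypotheses and forced constants of the four stubs

Deep-refute unit (refuter, D-0016 negative side) for the picked line `flattening-dilation` of the
crux `AperySectorThreeTwo` (route `HurwitzMicroSectors`). The four registered stubs
`stub_monomialFlatten`, `stub_polarDistribution`, `stub_normalFormReduction`,
`stub_normalFormRigidity` are all TRUE as registered (kernel-checked proofs with the verbatim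
signatures exist in the crux work-file `Cruxes/AperySectorThreeTwo/Disproof.lean` §8.1, re-checked
by this unit: rc 0, 0 sorry, axioms `propext`/`Classical.choice`/`Quot.sound`). What is PROVED here
is the complementary negative information a prover needs — every displayed constant is forced and
every structural hypothesis is load-bearing:

* §1 `stub_monomialFlatten` (`[box, c·tᵏ] − [box, c/(k+1)³] ∈ changeOfVariablesRel`): the target
  constant is the ONLY possible one (`monomialFlatten_target_unique`: any `d` that works for the
  canonical members equals `c/(k+1)³`, by soundness of rule 2); both domain clauses are
  load-bearing (`monomialFlatten_false_without_target_domain`,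
  `monomialFlatten_false_without_source_domain`: the empty-domain zero representation
  `KZ.exists_zeroRep ∅` satisfies every remaining hypothesis and has value `0 ≠ 1`).
* §2 `stub_polarDistribution` (`[box, c/(1−t²)] ~ [box, 7c·t/(1−t²)]`): the factor `7` is forced
  (`polarDistribution_factor_eq_seven`: `h₀ = 7h₁` and `ζ(3) > 0`, tree `Apery.zeta_three_pos`), and the target
  domain clause is load-bearing (`polarDistribution_false_without_target_domain`).
* §3 `stub_normalFormRigidity` (`a + b·t/(1−t²)` rigid under equal values): the value hypothesis
  is load-bearing (`normalFormRigidity_false_without_value`, witnesses `[box, 0]`, `[box, 1]`) and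
  so is the target domain clause even WITH the value hypothesis
  (`normalFormRigidity_false_without_target_domain`: `[box, 0]` and `[∅, ·]` both have value `0`).
* `stub_normalFormReduction` is an `∃`-statement proved outright in the Disproof (its two
  antecedents are not needed); nothing negative can be said about it and nothing is claimed.
* §4 the same two forced constants in the lead's sector dialect (`P ∼ₛ N` on canonical members,
  `Cruxes/AperySectorThreeTwo/Lines/flattening-dilation.lean`), incl. `[C 1] ∼ₛ [C 8 * X]` is NOT
  a relation (`sector_polar_eight_not_rel`).

Sources: M. Kontsevich, D. Zagier, *Periods* (2001), §1.2 (the rules); R. Apéry (1979) /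
F. Beukers (1979) for `ζ(3) ∉ ℚ` (tree: `Apery.irrational_zeta_three`).
-/

noncomputable section

open MeasureTheory Set
open Literature.NumberTheory.Transcendental Literature.ModelTheory.ExponentialFields

namespace Summit.KontsevichZagierPeriods.Theorems.AperySectorThreeTwo.Negative

/-! ## §0 Two more canonical members and the empty representation -/

/-- Value of the linear polar member: `∫_{(0,1)³} d·t/(1 − t²) = d·ζ(3)/8` (`h₁ = ζ(3)/8`).
[folklore] -/
theorem value_sectorRep_C_mul_X (d : ℚ) :
    (sectorRep (Polynomial.C d * Polynomial.X)).value = (d : ℝ) / 8 * zetaValue 3 := by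
  have h := BoxIntegral.box_integral_level_two_weight_three_one.2
  have hd : ∫ x in ubox, (d : ℝ) * ((x 0 * x 1 * x 2) ^ 1 / (1 - (x 0 * x 1 * x 2) ^ 2)) =
      (d : ℝ) / 8 * zetaValue 3 := by
    rw [MeasureTheory.integral_const_mul]
    show (d : ℝ) * ∫ x in {x : Fin 3 → ℝ | ∀ i, x i ∈ Ioo (0:ℝ) 1},
      (x 0 * x 1 * x 2) ^ 1 / (1 - (x 0 * x 1 * x 2) ^ 2) = _
    rw [h]; ring
  rw [← hd]
  show ∫ x in ubox, (sectorRep (Polynomial.C d * Polynomial.X)).integrand x = _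
  refine setIntegral_congr_fun measurableSet_ubox fun x _ => ?_
  simp [mul_div_assoc]

/-- A representation with EMPTY domain has value `0`. [folklore] -/
theorem value_eq_zero_of_domain_eq_empty {z : KZ.IntegralRep 3} (hz : z.domain = ∅) :
    z.value = 0 := by
  show ∫ x in z.domain, z.integrand x = 0
  rw [hz, Measure.restrict_empty, integral_zero_measure]

/-- Every `EqOn` hypothesis on a representation with empty domain holds. [folklore] -/
theorem eqOn_of_domain_eq_empty {z : KZ.IntegralRep 3} (hz : z.domain = ∅) (g : (Fin 3 → ℝ) → ℝ) :
    EqOn z.integrand g z.domain := by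
  rw [hz]; exact eqOn_empty _ _

/-- The empty-domain zero representation `[∅, 0]` exists in dimension `3`
(`KZ.exists_zeroRep` on the semialgebraic set `∅`). [folklore] -/
theorem exists_rep_domain_eq_empty : ∃ z : KZ.IntegralRep 3, z.domain = ∅ :=
  let ⟨z, hz, _⟩ := KZ.exists_zeroRep (n := 3) (σ := (∅ : Set (Fin 3 → ℝ))) isSemialgebraic_empty
  ⟨z, hz⟩

/-! ## §1 `stub_monomialFlatten`: forced target constant, load-bearing domain clauses -/

/-- **Tightness of `stub_monomialFlatten`.** If SOME constant target `d` makes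
`[box, c·tᵏ] − [box, d]` a change-of-variables instance for the canonical members, then
`d = c/(k+1)³`: rule 2 is sound (`KZ.Equivalent.value_eq_holds`) and
`∫_{(0,1)³} c·tᵏ = c/(k+1)³`. So the stub's constant is the only one that can be registered.
[folklore] -/
theorem monomialFlatten_target_unique (c : ℚ) (k : ℕ) (d : ℚ)
    (h : ∀ (r r' : KZ.IntegralRep 3), r.domain = {x | ∀ i, x i ∈ Set.Ioo (0:ℝ) 1} →
      r'.domain = {x | ∀ i, x i ∈ Set.Ioo (0:ℝ) 1} →
      Set.EqOn r.integrand (fun x => (c : ℝ) * (x 0 * x 1 * x 2) ^ k) r.domain →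
      Set.EqOn r'.integrand (fun _ => (d : ℝ)) r'.domain →
      KZ.of r - KZ.of r' ∈ KZ.changeOfVariablesRel) :
    (d : ℝ) = (c : ℝ) / ((k : ℝ) + 1) ^ 3 := by
  have hm := h (polyRep (Polynomial.C c * Polynomial.X ^ k)) (polyRep (Polynomial.C d)) rfl rfl
    (fun x _ => by simp) (fun x _ => by simp)
  have hv := KZ.Equivalent.value_eq_holds (KZ.changeOfVariablesRel_subset_relations hm)
  rw [value_polyRep_monomial, value_polyRep_C] at hv
  exact hv.symm

/-- In particular no constant other than `c/(k+1)³` flattens `c·tᵏ` (e.g. `[box, t] − [box, d]`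
is a rule-2 instance for the canonical members iff `d = 1/8`). [folklore] -/
theorem monomialFlatten_target_ne {c : ℚ} {k : ℕ} {d : ℚ} (hd : (d : ℝ) ≠ (c : ℝ) / ((k : ℝ) + 1) ^ 3) :
    ¬ ∀ (r r' : KZ.IntegralRep 3), r.domain = {x | ∀ i, x i ∈ Set.Ioo (0:ℝ) 1} →
      r'.domain = {x | ∀ i, x i ∈ Set.Ioo (0:ℝ) 1} →
      Set.EqOn r.integrand (fun x => (c : ℝ) * (x 0 * x 1 * x 2) ^ k) r.domain →
      Set.EqOn r'.integrand (fun _ => (d : ℝ)) r'.domain →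
      KZ.of r - KZ.of r' ∈ KZ.changeOfVariablesRel :=
  fun h => hd (monomialFlatten_target_unique c k d h)

/-- **The target domain clause of `stub_monomialFlatten` is load-bearing**: with
`r'.domain = box` deleted, `r' = [∅, 0]` satisfies the remaining hypotheses (its `EqOn` is vacuous)
against `r = [box, 1]` (`c = 1`, `k = 0`), and `1 ≠ 0 = value [∅, 0]`. [folklore] -/
theorem monomialFlatten_false_without_target_domain :
    ¬ ∀ (c : ℚ) (k : ℕ) (r r' : KZ.IntegralRep 3), r.domain = {x | ∀ i, x i ∈ Set.Ioo (0:ℝ) 1} →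
      Set.EqOn r.integrand (fun x => (c : ℝ) * (x 0 * x 1 * x 2) ^ k) r.domain →
      Set.EqOn r'.integrand (fun _ => (c : ℝ) / ((k : ℝ) + 1) ^ 3) r'.domain →
      KZ.of r - KZ.of r' ∈ KZ.changeOfVariablesRel := by
  intro h
  obtain ⟨z, hz⟩ := exists_rep_domain_eq_empty
  have hm := h 1 0 (polyRep (Polynomial.C 1 * Polynomial.X ^ 0)) z rfl
    (fun x _ => by simp) (eqOn_of_domain_eq_empty hz _)
  have hv := KZ.Equivalent.value_eq_holds (KZ.changeOfVariablesRel_subset_relations hm)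
  rw [value_polyRep_monomial, value_eq_zero_of_domain_eq_empty hz] at hv
  norm_num at hv

/-- **The source domain clause of `stub_monomialFlatten` is load-bearing**: with
`r.domain = box` deleted, `r = [∅, 0]` against `r' = [box, 1]` (`c = 1`, `k = 0`) satisfies the
remaining hypotheses and `0 ≠ 1`. [folklore] -/
theorem monomialFlatten_false_without_source_domain :
    ¬ ∀ (c : ℚ) (k : ℕ) (r r' : KZ.IntegralRep 3), r'.domain = {x | ∀ i, x i ∈ Set.Ioo (0:ℝ) 1} →
      Set.EqOn r.integrand (fun x => (c : ℝ) * (x 0 * x 1 * x 2) ^ k) r.domain →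
      Set.EqOn r'.integrand (fun _ => (c : ℝ) / ((k : ℝ) + 1) ^ 3) r'.domain →
      KZ.of r - KZ.of r' ∈ KZ.changeOfVariablesRel := by
  intro h
  obtain ⟨z, hz⟩ := exists_rep_domain_eq_empty
  have hm := h 1 0 z (polyRep (Polynomial.C 1)) rfl (eqOn_of_domain_eq_empty hz _)
    (fun x _ => by simp)
  have hv := KZ.Equivalent.value_eq_holds (KZ.changeOfVariablesRel_subset_relations hm)
  rw [value_polyRep_C, value_eq_zero_of_domain_eq_empty hz] at hv
  norm_num at hv

/-! ## §2 `stub_polarDistribution`: the factor `7` is forced, target domain clause load-bearing -/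

/-- **Tightness of `stub_polarDistribution`.** If a rational factor `d` makes
`[box, c/(1−t²)] ~ [box, d·c·t/(1−t²)]` for all `c` and all members, then `d = 7`:
at `c = 1` the values are `7ζ(3)/8` and `dζ(3)/8`, and `ζ(3) ≠ 0`. [folklore] -/
theorem polarDistribution_factor_eq_seven (d : ℚ)
    (h : ∀ (c : ℚ) (r r' : KZ.IntegralRep 3), r.domain = {x | ∀ i, x i ∈ Set.Ioo (0:ℝ) 1} →
      r'.domain = {x | ∀ i, x i ∈ Set.Ioo (0:ℝ) 1} →
      Set.EqOn r.integrand (fun x => (c : ℝ) / (1 - (x 0 * x 1 * x 2) ^ 2)) r.domain →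
      Set.EqOn r'.integrand
        (fun x => (d : ℝ) * (c : ℝ) * (x 0 * x 1 * x 2) / (1 - (x 0 * x 1 * x 2) ^ 2)) r'.domain →
      KZ.Equivalent r r') : d = 7 := by
  have he := h 1 (sectorRep (Polynomial.C 1)) (sectorRep (Polynomial.C d * Polynomial.X)) rfl rfl
    (fun x _ => by simp) (fun x _ => by simp [mul_div_assoc])
  have hv := KZ.Equivalent.value_eq_holds he
  rw [value_sectorRep_one, value_sectorRep_C_mul_X] at hv
  have h8 : (7 : ℝ) = (d : ℝ) := by
    have := mul_right_cancel₀ Apery.zeta_three_pos.ne' hv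
    linarith
  exact_mod_cast h8.symm

/-- In particular the stub with any factor `d ≠ 7` (e.g. `8`, the level count `2³`) is FALSE.
[folklore] -/
theorem polarDistribution_false_of_ne_seven {d : ℚ} (hd : d ≠ 7) :
    ¬ ∀ (c : ℚ) (r r' : KZ.IntegralRep 3), r.domain = {x | ∀ i, x i ∈ Set.Ioo (0:ℝ) 1} →
      r'.domain = {x | ∀ i, x i ∈ Set.Ioo (0:ℝ) 1} →
      Set.EqOn r.integrand (fun x => (c : ℝ) / (1 - (x 0 * x 1 * x 2) ^ 2)) r.domain →
      Set.EqOn r'.integrand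
        (fun x => (d : ℝ) * (c : ℝ) * (x 0 * x 1 * x 2) / (1 - (x 0 * x 1 * x 2) ^ 2)) r'.domain →
      KZ.Equivalent r r' :=
  fun h => hd (polarDistribution_factor_eq_seven d h)

/-- **The target domain clause of `stub_polarDistribution` is load-bearing**: `r' = [∅, 0]`
against `r = [box, 1/(1−t²)]` (`c = 1`): `7ζ(3)/8 ≠ 0`. [folklore] -/
theorem polarDistribution_false_without_target_domain :
    ¬ ∀ (c : ℚ) (r r' : KZ.IntegralRep 3), r.domain = {x | ∀ i, x i ∈ Set.Ioo (0:ℝ) 1} →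
      Set.EqOn r.integrand (fun x => (c : ℝ) / (1 - (x 0 * x 1 * x 2) ^ 2)) r.domain →
      Set.EqOn r'.integrand
        (fun x => 7 * (c : ℝ) * (x 0 * x 1 * x 2) / (1 - (x 0 * x 1 * x 2) ^ 2)) r'.domain →
      KZ.Equivalent r r' := by
  intro h
  obtain ⟨z, hz⟩ := exists_rep_domain_eq_empty
  have he := h 1 (sectorRep (Polynomial.C 1)) z rfl (fun x _ => by simp)
    (eqOn_of_domain_eq_empty hz _)
  have hv := KZ.Equivalent.value_eq_holds he
  rw [value_sectorRep_one, value_eq_zero_of_domain_eq_empty hz] at hv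
  have : (7 / 8 : ℝ) * zetaValue 3 ≠ 0 := mul_ne_zero (by norm_num) Apery.zeta_three_pos.ne'
  exact this hv

/-! ## §3 `stub_normalFormRigidity`: value hypothesis and target domain clause load-bearing -/

/-- **The value hypothesis of `stub_normalFormRigidity` is load-bearing**: `[box, 0]`
(`a = b = 0`) and `[box, 1]` (`a' = 1`, `b' = 0`) satisfy every other hypothesis and `0 ≠ 1`.
[folklore] -/
theorem normalFormRigidity_false_without_value :
    ¬ ∀ (a b a' b' : ℚ) (r r' : KZ.IntegralRep 3), r.domain = {x | ∀ i, x i ∈ Set.Ioo (0:ℝ) 1} →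
      Set.EqOn r.integrand
        (fun x => (a : ℝ) + (b : ℝ) * (x 0 * x 1 * x 2) / (1 - (x 0 * x 1 * x 2) ^ 2)) r.domain →
      r'.domain = {x | ∀ i, x i ∈ Set.Ioo (0:ℝ) 1} →
      Set.EqOn r'.integrand
        (fun x => (a' : ℝ) + (b' : ℝ) * (x 0 * x 1 * x 2) / (1 - (x 0 * x 1 * x 2) ^ 2)) r'.domain →
      a = a' ∧ b = b' := by
  intro h
  have := (h 0 0 1 0 (polyRep (Polynomial.C 0)) (polyRep (Polynomial.C 1)) rfl (fun x _ => by simp)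
    rfl (fun x _ => by simp)).1
  norm_num at this

/-- **The target domain clause of `stub_normalFormRigidity` is load-bearing even with the value
hypothesis kept**: `r = [box, 0]` (`a = b = 0`) and `r' = [∅, 0]` read as `a' = 1`, `b' = 0`
(vacuous `EqOn`) have equal values `0 = 0`, yet `a ≠ a'`. [folklore] -/
theorem normalFormRigidity_false_without_target_domain :
    ¬ ∀ (a b a' b' : ℚ) (r r' : KZ.IntegralRep 3), r.domain = {x | ∀ i, x i ∈ Set.Ioo (0:ℝ) 1} →
      Set.EqOn r.integrand
        (fun x => (a : ℝ) + (b : ℝ) * (x 0 * x 1 * x 2) / (1 - (x 0 * x 1 * x 2) ^ 2)) r.domain →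
      Set.EqOn r'.integrand
        (fun x => (a' : ℝ) + (b' : ℝ) * (x 0 * x 1 * x 2) / (1 - (x 0 * x 1 * x 2) ^ 2)) r'.domain →
      r.value = r'.value → a = a' ∧ b = b' := by
  intro h
  obtain ⟨z, hz⟩ := exists_rep_domain_eq_empty
  have hv : (polyRep (Polynomial.C 0)).value = z.value := by
    rw [value_polyRep_C, value_eq_zero_of_domain_eq_empty hz]; norm_num
  have := (h 0 0 1 0 (polyRep (Polynomial.C 0)) z rfl (fun x _ => by simp)
    (eqOn_of_domain_eq_empty hz _) hv).1
  norm_num at this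

/-! ## §4 The same tightness in the lead's sector dialect (`Lines/flattening-dilation.lean`)

The lead's skeleton states the stubs for the canonical members only:
`stub_monomialFlatten (c k) : [C c * X^k * (1 − X²)] ∼ₛ [C (c/(k+1)³) * (1 − X²)]`,
`stub_polarDistribution (c) : [C c] ∼ₛ [C (7c) * X]`, where `P ∼ₛ N` is
`KZ.of (sectorRep P) - KZ.of (sectorRep N) ∈ KZ.relations`. Both constants are forced there too. -/

/-- The member with numerator `Q·(1 − X²)` has the value of `[box, Q]` (same domain, integrands
agree on it). [folklore] -/
theorem value_sectorRep_mul_one_sub_sq (Q : Polynomial ℚ) :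
    (sectorRep (Q * (1 - Polynomial.X ^ 2))).value = (polyRep Q).value :=
  (KZ.Equivalent.value_eq_holds
    (KZ.of_sub_of_mem_relations_of_eqOn (r := polyRep Q) (r' := sectorRep (Q * (1 - Polynomial.X ^ 2)))
      rfl (polyRep_eqOn Q))).symm

/-- **Sector form of the flattening tightness**: if `[C c * X^k * (1 − X²)] ∼ₛ [C d * (1 − X²)]`
then `d = c/(k+1)³`. [folklore] -/
theorem sector_monomialFlatten_target_unique {c d : ℚ} {k : ℕ}
    (h : KZ.of (sectorRep (Polynomial.C c * Polynomial.X ^ k * (1 - Polynomial.X ^ 2))) -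
      KZ.of (sectorRep (Polynomial.C d * (1 - Polynomial.X ^ 2))) ∈ KZ.relations) :
    (d : ℝ) = (c : ℝ) / ((k : ℝ) + 1) ^ 3 := by
  have hv := KZ.Equivalent.value_eq_holds h
  rw [value_sectorRep_mul_one_sub_sq, value_sectorRep_mul_one_sub_sq, value_polyRep_monomial,
    value_polyRep_C] at hv
  exact hv.symm

/-- **Sector form of the polar tightness**: if `[C 1] ∼ₛ [C d * X]` then `d = 7`
(`h₀ = 7ζ(3)/8`, `value [C d * X] = dζ(3)/8`, `ζ(3) ≠ 0`). [folklore] -/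
theorem sector_polarDistribution_factor_eq_seven {d : ℚ}
    (h : KZ.of (sectorRep (Polynomial.C 1)) - KZ.of (sectorRep (Polynomial.C d * Polynomial.X)) ∈
      KZ.relations) : d = 7 := by
  have hv := KZ.Equivalent.value_eq_holds h
  rw [value_sectorRep_one, value_sectorRep_C_mul_X] at hv
  have h8 : (7 : ℝ) = (d : ℝ) := by
    have := mul_right_cancel₀ Apery.zeta_three_pos.ne' hv
    linarith
  exact_mod_cast h8.symm

/-- In particular the naive "level count" target `[C 1] ∼ₛ [C 8 * X]` (`H₀ ∼ 8H₁`, forgetting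
that `H₀ + H₁`, not `H₀`, is the `m = 2` push-forward) is NOT a relation. [folklore] -/
theorem sector_polar_eight_not_rel :
    KZ.of (sectorRep (Polynomial.C 1)) - KZ.of (sectorRep (Polynomial.C 8 * Polynomial.X)) ∉
      KZ.relations :=
  fun h => by have := sector_polarDistribution_factor_eq_seven h; norm_num at this

end Summit.KontsevichZagierPeriods.Theorems.AperySectorThreeTwo.Negative

end
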